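import Summits.FinalStateConjecture.FinalStateConjecture.Theorems.ClusterCompletenessOmegaLimitMultiKerrTranslateCompactness
import HarnessLib

/-!
# Route ClusterCompleteness · crux `OmegaLimitMultiKerr` — ORDER UPGRADE: under `C^{k+1}` bounds,
# pointwise `C⁰` recurrence of the translates on an OPEN set is already `Cᵏ` recurrence on its compacts

Structure lemma for the crux stmt-FinalStateConjecture-14664 (`ClusterCompleteness.OmegaLimitMultiKerr`,
rank 9), line `Sketch`, lead gen 3. The crux is stated for EVERY order `k` (`∀ k, OmegaAt k`, antitone in
`k`), and its recur-disjunct measures `Cᵏ` closeness at INSTANTS `{t = τ}`. For TAME era charts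
(all-time `C^{k+1}` bounds, the generic stub of the recommended re-line) the order is immaterial as
soon as closeness is measured on sets with nonempty INTERIOR in spacetime (thick windows
`{τ − L < t < τ + L}` instead of instants):

**Theorem (`tendsto_supCkENorm_translate_of_tendsto_on_open`).** In the setting of
`exists_strictMono_tendsto_supCkENorm_translate_sub` (`h ∈ C^{k+1}(O)`, `O` open and forward-invariant
under `x ↦ x + s • w`, times `T n ≥ 0`, eventually-uniform `C^{k+1}` bounds of the translates on
compacts), if the translates `h (x + T n • w)` tend to `0` merely POINTWISE at every point of an open set
`V ⊆ O`, then they tend to `0` in `Cᵏ` uniformly on every compact `K ⊆ V` — along the WHOLE sequence.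

Proof: every subsequence has, by the `Cᵏ` Arzelà–Ascoli theorem on translates, a further subsequence
converging in `Cᵏ_loc` to some `g`; the pointwise hypothesis forces `g = 0` on the open set `V`, so all
derivatives of `g` vanish on `V` and the `Cᵏ` sup norms over `K ⊆ V` of the translates tend to `0`
along that sub-subsequence; the subsequence principle (`tendsto_of_subseq_tendsto`) concludes. No
interpolation inequality is needed. Reading for the crux: "coarse-in-derivatives recurrence on thick
windows + tameness ⇒ fine recurrence at every order" (the quantifier trade of idea card
`long-coarse-windows-breed-fine-instants`, in its `ε → 0` form); in particular for tame developments
`Recurs` at order `0` on thick windows gives `Recurs` at order `k` on compact near zones.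
Hale 1980, Ch. I, §8; Petersen 2006, Ch. 10, §3.1.
-/

-- every `Summit.FinalStateConjecture.FinalStateConjecture.…` name repeats the summit = sub-problem segment (D-0017 layout)
set_option linter.dupNamespace false

noncomputable section

open Set Filter Topology Function
open scoped ContDiff Topology ENNReal

namespace Summit.FinalStateConjecture.FinalStateConjecture.Theorems.ClusterCompleteness

open Literature.Geometry.Lorentzian

/-- **Order upgrade: pointwise `C⁰` recurrence on an open set is `Cᵏ` recurrence on its compacts,
under eventually-uniform `C^{k+1}` bounds.** For `h` of class `C^{k+1}` on an open set `O`
forward-invariant under `x ↦ x + s • w` (`s ≥ 0`), nonnegative times `T n` with eventually-uniform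
bounds on the derivatives of order `≤ k + 1` of the translates on each compact of `O`, and an open
`V ⊆ O` on which the translates `h (x + T n • w)` tend to `0` pointwise, the `Cᵏ` sup norms of the
translates over every compact `K ⊆ V` tend to `0` (subsequence principle + `Cᵏ` Arzelà–Ascoli on
translates; Hale 1980, Ch. I, §8; Petersen 2006, Ch. 10, §3.1). [cite: Petersen2006, Ch. 10 §3.1] -/
theorem tendsto_supCkENorm_translate_of_tendsto_on_open :
    ∀ {E : Type*} [NormedAddCommGroup E] [NormedSpace ℝ E] [FiniteDimensional ℝ E]
      {W : Type*} [NormedAddCommGroup W] [NormedSpace ℝ W] [FiniteDimensional ℝ W] {O : Set E},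
      IsOpen O → ∀ {w : E}, (∀ x ∈ O, ∀ s : ℝ, 0 ≤ s → x + s • w ∈ O) →
      ∀ {k : ℕ} {h : E → W}, ContDiffOn ℝ (k + 1) h O → ∀ {T : ℕ → ℝ}, (∀ n, 0 ≤ T n) →
      (∀ K ⊆ O, IsCompact K → ∃ Λ : ℝ, ∀ᶠ n in atTop, ∀ i, i ≤ k + 1 → ∀ z ∈ K,
        ‖iteratedFDeriv ℝ i h (z + T n • w)‖ ≤ Λ) →
      ∀ {V : Set E}, IsOpen V → V ⊆ O →
      (∀ x ∈ V, Tendsto (fun n ↦ h (x + T n • w)) atTop (𝓝 0)) →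
      ∀ K ⊆ V, IsCompact K →
        Tendsto (fun n ↦ supCkENorm K k (fun x ↦ h (x + T n • w))) atTop (𝓝 0) := by
  intro E _ _ _ W _ _ _ O hO w hOw k h hh T hT hb V hV hVO hpt K hKV hK
  refine tendsto_of_subseq_tendsto fun ns hns ↦ ?_
  -- Arzelà–Ascoli along the subsequence `T ∘ ns`
  have hT' : ∀ n, 0 ≤ T (ns n) := fun n ↦ hT (ns n)
  have hb' : ∀ K ⊆ O, IsCompact K → ∃ Λ : ℝ, ∀ᶠ n in atTop, ∀ i, i ≤ k + 1 → ∀ z ∈ K,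
      ‖iteratedFDeriv ℝ i h (z + T (ns n) • w)‖ ≤ Λ := by
    intro K' hK'O hK'
    obtain ⟨Λ, hΛ⟩ := hb K' hK'O hK'
    exact ⟨Λ, hns.eventually hΛ⟩
  obtain ⟨g, φ, hφ, hg, hlim⟩ :=
    exists_strictMono_tendsto_supCkENorm_translate_sub hO hOw hh hT' hb'
  refine ⟨φ, ?_⟩
  -- the limit vanishes on `V`
  have hg0 : ∀ x ∈ V, g x = 0 := by
    intro x hx
    have h1 : Tendsto (fun n ↦ supCkENorm {x} k (fun y ↦ h (y + T (ns (φ n)) • w) - g y)) atTop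
        (𝓝 0) := hlim {x} (singleton_subset_iff.2 (hVO hx)) isCompact_singleton
    have h2 : Tendsto (fun n ↦ h (x + T (ns (φ n)) • w)) atTop (𝓝 0) :=
      (hpt x hx).comp (hns.comp hφ.tendsto_atTop)
    -- `‖h (x + T (ns (φ n)) • w) - g x‖ₑ → 0`
    have h3 : Tendsto (fun n ↦ ‖h (x + T (ns (φ n)) • w) - g x‖ₑ) atTop (𝓝 0) := by
      refine tendsto_of_tendsto_of_tendsto_of_le_of_le tendsto_const_nhds h1
        (fun _ ↦ zero_le) fun n ↦ ?_
      have hle := enorm_iteratedFDeriv_le_supCkENorm (Nat.zero_le k) (mem_singleton x)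
        (fun y ↦ h (y + T (ns (φ n)) • w) - g y)
      have e0 : ‖iteratedFDeriv ℝ 0 (fun y ↦ h (y + T (ns (φ n)) • w) - g y) x‖ₑ =
          ‖h (x + T (ns (φ n)) • w) - g x‖ₑ := by
        rw [enorm_eq_nnnorm, enorm_eq_nnnorm]
        exact congrArg _ (NNReal.eq (by simp only [coe_nnnorm, norm_iteratedFDeriv_zero]))
      exact e0 ▸ hle
    have h4 : Tendsto (fun n ↦ h (x + T (ns (φ n)) • w) - g x) atTop (𝓝 0) :=
      tendsto_zero_iff_enorm_tendsto_zero.2 h3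
    have h5 : Tendsto (fun n ↦ h (x + T (ns (φ n)) • w) - (h (x + T (ns (φ n)) • w) - g x))
        atTop (𝓝 (0 - 0)) := h2.sub h4
    simp only [sub_sub_cancel, sub_zero] at h5
    exact tendsto_nhds_unique tendsto_const_nhds h5
  -- hence all its derivatives vanish on `V`
  have hjet : ∀ x ∈ V, ∀ m, iteratedFDeriv ℝ m g x = 0 := by
    intro x hx m
    have hev : g =ᶠ[𝓝 x] fun _ ↦ (0 : W) :=
      Filter.eventually_of_mem (hV.mem_nhds hx) fun y hy ↦ hg0 y hy
    rw [(hev.iteratedFDeriv ℝ m).eq_of_nhds, iteratedFDeriv_fun_zero]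
    rfl
  -- and the `Cᵏ` sup norms over `K` agree with those of the differences, which tend to `0`
  have heq : ∀ n, supCkENorm K k (fun x ↦ h (x + T (ns (φ n)) • w)) =
      supCkENorm K k (fun x ↦ h (x + T (ns (φ n)) • w) - g x) := by
    intro n
    unfold supCkENorm
    refine iSup_congr fun m ↦ iSup_congr fun hm ↦ iSup_congr fun x ↦ iSup_congr fun hx ↦ ?_
    have hxO : x ∈ O := hVO (hKV hx)
    have hgn : ContDiffAt ℝ m g x :=
      (hg.of_le (by exact_mod_cast hm)).contDiffAt (hO.mem_nhds hxO)
    have hhn : ContDiffAt ℝ m (fun y ↦ h (y + T (ns (φ n)) • w)) x := by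
      have hmem : x + T (ns (φ n)) • w ∈ O := hOw _ hxO _ (hT _)
      have h' : ContDiffAt ℝ m h (x + T (ns (φ n)) • w) :=
        (hh.of_le (by exact_mod_cast Nat.le_succ_of_le hm)).contDiffAt (hO.mem_nhds hmem)
      exact h'.comp x (contDiffAt_id.add contDiffAt_const)
    have hsub : iteratedFDeriv ℝ m (fun y ↦ h (y + T (ns (φ n)) • w) - g y) x =
        iteratedFDeriv ℝ m (fun y ↦ h (y + T (ns (φ n)) • w)) x - iteratedFDeriv ℝ m g x :=
      iteratedFDeriv_sub_apply hhn hgn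
    rw [hsub, hjet x (hKV hx) m, sub_zero]
  show Tendsto (fun n ↦ supCkENorm K k (fun x ↦ h (x + T (ns (φ n)) • w))) atTop (𝓝 0)
  simp_rw [heq]
  exact hlim K (hKV.trans hVO) hK

end Summit.FinalStateConjecture.FinalStateConjecture.Theorems.ClusterCompleteness

end
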